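import Literature.Geometry.Lorentzian.KIDPatchImmersion
import Literature.Geometry.Manifold.TranslationDevelopment
import HarnessLib

/-!
# Translational KIDs on a simply connected `3`-manifold integrate to a global immersion into
# Minkowski space-time

The developing map of the proof of the rigid positive energy theorem (Beig–Chruściel, J. Math.
Phys. 37 (1996), Thm. 4.1, §4: "as `Σ` is simply connected … there exists an isometric
embedding `i` of `Σ` into Minkowski space-time such that `K_{ij}` represents the extrinsic
curvature tensor of `i(Σ)`"), directly on the data and without the Killing development:

* `InitialDataSet.exists_minkowski_immersion_of_kids` — a simply connected `3`-dimensional data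
  set `(X, h, k)` carrying smooth lapses and shifts `(N_a, Y_a)_{a<4}` which solve the
  translational KID system `h(∇ᵤY_a, w) = −N_a k(u, w)`, `dN_a(u) = −k(u, Y_a)` with Gram
  matrix `−N_a N_b + h(Y_a, Y_b) = η_{ab}` and `N₀ > 0` admits a global smooth spacelike
  immersion `f : X → (ℝ⁴, η)` with future unit normal `ν = (−ε_a N_a)_a` (smooth lift),
  `df = (ε_a h(Y_a, ·))_a`, `f^*η = h` and `K_ν = k`.

Proof: the local immersions of `exists_local_minkowski_immersion_of_kids`
(`KIDPatchImmersion.lean`) have the prescribed differential `(ε_a h(Y_a, ·))_a`, so two of them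
differ by a constant near every common point (`exists_eventuallyEq_add_const_of_mfderiv_eq`);
by `exists_glue_of_locally_eq_add_const` (`Literature/Geometry/Manifold/TranslationDevelopment`
— the development theorem for the translation group, i.e. monodromy on the simply connected `X`)
they glue, modulo translations of `ℝ⁴`, to a global map, which near every point is a translate
of a local immersion and so has the same differential, induced metric and second fundamental
form (`ModelSpace.secondFundamentalForm_eq_mfderiv`: `K` only depends on `dν` and `df`).
Injectivity of `f` and the Cauchy property of its image — the remaining assertions of Thm. 4.1 —
need the asymptotic flatness and are not treated here. Theorems only; no definitions, no named
facts.

## References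

* R. Beig, P. T. Chruściel, *Killing vectors in asymptotically flat space-times. I.*, J. Math.
  Phys. 37 (1996) 1939–1961, Thm. 4.1 and its proof, §4; App. A. [BeigChrusciel1996]
* R. Benedetti, C. Petronio, *Lectures on Hyperbolic Geometry*, Springer 1992, Prop. B.1.3
  (developing map). [BenedettiPetronio1992]
-/

noncomputable section

open Bundle Set Function Filter Manifold
open scoped Manifold ContDiff Topology

namespace Literature.Geometry.Lorentzian

namespace InitialDataSet

variable {X : Type*} [TopologicalSpace X] [ChartedSpace E3 X] [IsManifold (𝓡 3) ∞ X]
  (D : InitialDataSet (𝓡 3) X) [D.metric.HasLeviCivita]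
  (N : Fin 4 → X → ℝ) (Y : Fin 4 → Π x : X, TangentSpace (𝓡 3) x)

/-- **The developing map of translational KIDs on a simply connected `3`-manifold.** Let
`(X, h, k)` be a simply connected `3`-dimensional initial data set carrying smooth lapses and
shifts `(N_a, Y_a)_{a<4}` solving the translational KID system
`h(∇ᵤY_a, w) = −N_a k(u, w)`, `dN_a(u) = −k(u, Y_a)` with Minkowskian Gram matrix
`−N_a N_b + h(Y_a, Y_b) = η_{ab}` and `N₀ > 0`. Then there is a GLOBAL smooth spacelike
immersion `f : X → (ℝ⁴, η)` with future unit normal `ν = (−ε_a N_a)_a` (smooth lift),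
`df = (ε_a h(Y_a, ·))_a`, `f^*η = h` and `K_ν = k`. Proof: the local immersions of
`exists_local_minkowski_immersion_of_kids` (`KIDPatchImmersion.lean`) all have the same
differential `(ε_a h(Y_a, ·))_a`, so any two differ by a constant near every common point
(`exists_eventuallyEq_add_const_of_mfderiv_eq`); on the simply connected `X` they glue, modulo
translations of `ℝ⁴`, to a global map (`exists_glue_of_locally_eq_add_const`,
`TranslationDevelopment.lean` — the developing map), which near every point is a translate of
a local immersion and hence has the same induced metric and second fundamental form. This is
the passage "`Σ` simply connected … isometric embedding `i` of `Σ` into Minkowski space-time"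
of the proof of Beig–Chruściel, J. Math. Phys. 37 (1996), Thm. 4.1 (§4; there via the Killing
development, here directly on the data).
[cite: BeigChrusciel1996, proof of Thm. 4.1, §4] -/
theorem exists_minkowski_immersion_of_kids [SimplyConnectedSpace X]
    (hN : ∀ a, ContMDiff (𝓡 3) 𝓘(ℝ, ℝ) ∞ (N a))
    (hY : ∀ a, ContMDiff (𝓡 3) ((𝓡 3).prod (𝓡 3)) ∞
      fun x ↦ (TotalSpace.mk' E3 x (Y a x) : TangentBundle (𝓡 3) X))
    (hDY : ∀ a (x : X) (v w : TangentSpace (𝓡 3) x),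
      D.metric.val x (D.metric.leviCivita (Y a) x v) w = -(N a x * D.k x v w))
    (hdN : ∀ a (x : X) (v : TangentSpace (𝓡 3) x),
      mvfderiv (𝓡 3) (N a) x v = -(D.k x v (Y a x)))
    (hG : ∀ x a b, -(N a x * N b x) + D.h.inner x (Y a x) (Y b x) =
      if a = b then (if a = 0 then -1 else 1) else 0)
    (hN0 : ∀ x, 0 < N 0 x) :
    ∃ (f : X → E4) (ν : X → E4),
      Minkowski.smoothMetric.toPseudoRiemannianMetric.IsSpacelikeImmersion (𝓡 3) f ∧
      Minkowski.smoothMetric.IsFutureUnitNormal (𝓡 3) (Minkowski.timeOrientation.ofLE le_top)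
        f ν ∧
      ContMDiff (𝓡 3) 𝓘(ℝ, E4).tangent ∞
        (fun x ↦ (TotalSpace.mk' E4 (f x) (ν x) : TangentBundle 𝓘(ℝ, E4) E4)) ∧
      (∀ (x : X) (v : E3), mfderiv (𝓡 3) 𝓘(ℝ, E4) f x v =
        WithLp.toLp 2 fun a ↦ (if a = 0 then -1 else 1 : ℝ) * D.h.inner x (Y a x) v) ∧
      (∀ x : X, ν x = WithLp.toLp 2 fun a ↦ -((if a = 0 then -1 else 1 : ℝ) * N a x)) ∧
      (∀ (x : X) (v w : E3),
        Minkowski.smoothMetric.toPseudoRiemannianMetric.inducedBilin (𝓡 3) f x v w =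
          D.h.inner x v w) ∧
      ∀ [Minkowski.smoothMetric.toPseudoRiemannianMetric.HasLeviCivita] (x : X) (v w : E3),
        Minkowski.smoothMetric.toPseudoRiemannianMetric.secondFundamentalForm (𝓡 3) f ν x v w =
          D.k x v w := by
  classical
  haveI : LocallyPathConnectedSpace X := ChartedSpace.locallyPathConnectedSpace E3 X
  have H := fun x ↦ D.exists_local_minkowski_immersion_of_kids N Y hN hY hDY hdN x (hG x) (hN0 x)
  choose V hxV fl νl hfi hun hlift hdf hνl hind hK using H
  -- the local immersions as total functions on `X`
  set φ : X → X → E4 := fun i y ↦ if h : y ∈ V i then fl i ⟨y, h⟩ else 0 with hφ_def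
  have hφf : ∀ i (y : V i), φ i y = fl i y := fun i y ↦ by
    simp only [hφ_def, dif_pos y.2]
  have hφfun : ∀ i, (fun y : V i ↦ φ i y) = fl i := fun i ↦ funext (hφf i)
  have hφs : ∀ i (x : X) (hx : x ∈ (V i : Set X)), ContMDiffAt (𝓡 3) 𝓘(ℝ, E4) ∞ (φ i) x := by
    intro i x hx
    have h := (hfi i).contMDiff_self ⟨x, hx⟩
    rw [← hφfun i] at h
    exact contMDiffAt_subtype_iff.mp h
  have hφd : ∀ i (x : X) (hx : x ∈ (V i : Set X)) (v : E3), mfderiv (𝓡 3) 𝓘(ℝ, E4) (φ i) x v =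
      WithLp.toLp 2 fun a ↦ (if a = 0 then -1 else 1 : ℝ) * D.h.inner x (Y a x) v := by
    intro i x hx v
    have h1 : mfderiv (𝓡 3) 𝓘(ℝ, E4) (φ i ∘ Subtype.val : V i → E4) ⟨x, hx⟩ =
        mfderiv (𝓡 3) 𝓘(ℝ, E4) (φ i) x :=
      mfderiv_comp_subtypeVal ((hφs i x hx).mdifferentiableAt (by simp))
    have h2 : (φ i ∘ Subtype.val : V i → E4) = fl i := hφfun i
    rw [← h1, h2]
    exact hdf i ⟨x, hx⟩ v
  -- any two differ locally by a constant
  have hcompat : ∀ i j x, x ∈ (V i : Set X) → x ∈ (V j : Set X) →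
      ∃ c : E4, φ j =ᶠ[𝓝 x] fun y ↦ φ i y + c := by
    intro i j x hi hj
    apply Literature.Geometry.Manifold.exists_eventuallyEq_add_const_of_mfderiv_eq (I := 𝓡 3)
    filter_upwards [(V i).isOpen.mem_nhds hi, (V j).isOpen.mem_nhds hj] with z hzi hzj
    exact ⟨(hφs i z hzi).mdifferentiableAt (by simp), (hφs j z hzj).mdifferentiableAt (by simp),
      ContinuousLinearMap.ext fun v ↦ (hφd i z hzi v).trans (hφd j z hzj v).symm⟩
  -- glue
  obtain ⟨F, hF⟩ := Literature.Geometry.Manifold.exists_glue_of_locally_eq_add_const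
    (fun i ↦ (V i).isOpen) (fun x ↦ ⟨x, hxV x⟩) hcompat
  -- local form of `F` and its first-order consequences
  have hFs : ∀ x, ContMDiffAt (𝓡 3) 𝓘(ℝ, E4) ∞ F x ∧ ∀ v : E3, mfderiv (𝓡 3) 𝓘(ℝ, E4) F x v =
      WithLp.toLp 2 fun a ↦ (if a = 0 then -1 else 1 : ℝ) * D.h.inner x (Y a x) v := by
    intro x
    obtain ⟨i, c, hx, hFx⟩ := hF x
    have hs : ContMDiffAt (𝓡 3) 𝓘(ℝ, E4) ∞ (fun y ↦ φ i y + c) x :=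
      (hφs i x hx).add contMDiffAt_const
    refine ⟨hs.congr_of_eventuallyEq hFx, fun v ↦ ?_⟩
    have hd : MDifferentiableAt (𝓡 3) 𝓘(ℝ, E4) (φ i) x := (hφs i x hx).mdifferentiableAt (by simp)
    have h3 : HasMFDerivAt (𝓡 3) 𝓘(ℝ, E4) (φ i + fun _ ↦ c) x
        (mfderiv (𝓡 3) 𝓘(ℝ, E4) (φ i) x + 0) :=
      hd.hasMFDerivAt.add (hasMFDerivAt_const c x)
    have h4 : mfderiv (𝓡 3) 𝓘(ℝ, E4) (φ i + fun _ ↦ c) x v = mfderiv (𝓡 3) 𝓘(ℝ, E4) (φ i) x v := by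
      rw [h3.mfderiv]
      exact add_zero _
    have e1 : mfderiv (𝓡 3) 𝓘(ℝ, E4) F x = mfderiv (𝓡 3) 𝓘(ℝ, E4) (φ i + fun _ ↦ c) x :=
      hFx.mfderiv_eq
    exact ((congrArg (fun L ↦ L v) e1).trans h4).trans (hφd i x hx v)
  -- the normal
  set ν : X → E4 := fun x ↦ WithLp.toLp 2 fun a ↦ -((if a = 0 then -1 else 1 : ℝ) * N a x)
    with hν_def
  have hνs : ContMDiff (𝓡 3) 𝓘(ℝ, E4) ∞ ν := by
    have h1 : ContMDiff (𝓡 3) 𝓘(ℝ, Fin 4 → ℝ) ∞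
        (fun x ↦ fun a ↦ -((if a = 0 then -1 else 1 : ℝ) * N a x)) :=
      contMDiff_pi_space.mpr fun a ↦ (contMDiff_const.mul (hN a)).neg
    exact (EuclideanSpace.equiv (Fin 4) ℝ).symm.contDiff.contMDiff.comp h1
  have hνl : ∀ i (y : V i), νl i y = ν y := fun i y ↦ hνl i y
  -- pointwise identifications with the patch through `x`
  have hFd : ∀ x, MDifferentiableAt (𝓡 3) 𝓘(ℝ, E4) F x := fun x ↦
    (hFs x).1.mdifferentiableAt (by simp)
  have hdFl : ∀ i (x : X) (hx : x ∈ (V i : Set X)) (v : E3),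
      mfderiv (𝓡 3) 𝓘(ℝ, E4) F x v = mfderiv 𝓘(ℝ, E3) 𝓘(ℝ, E4) (fl i) ⟨x, hx⟩ v := by
    intro i x hx v
    rw [(hFs x).2 v, hdf i ⟨x, hx⟩ v]
  have hval : ∀ (p : E4) (a b : E4),
      Minkowski.smoothMetric.toPseudoRiemannianMetric.val p a b = Minkowski.bilin a b :=
    fun _ _ _ ↦ rfl
  have hind' : ∀ (x : X) (v w : E3),
      Minkowski.smoothMetric.toPseudoRiemannianMetric.inducedBilin (𝓡 3) F x v w =
        D.h.inner x v w := by
    intro x v w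
    rw [← hind x ⟨x, hxV x⟩ v w, PseudoRiemannianMetric.inducedBilin_apply,
      PseudoRiemannianMetric.inducedBilin_apply, hval, hval, hdFl x x (hxV x), hdFl x x (hxV x)]
  refine ⟨F, ν, ⟨fun x ↦ ((hFs x).1.of_le (le_of_eq rfl)), fun x v hv ↦ ?_⟩,
    ⟨⟨fun x v ↦ ?_, fun x ↦ ?_⟩, fun x ↦ ?_⟩, fun x ↦ ?_, fun x v ↦ (hFs x).2 v, fun _ ↦ rfl,
    hind', ?_⟩
  · -- spacelike
    rw [hind' x v v]
    exact D.h.pos x v hv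
  · -- normal
    rw [hval, hdFl x x (hxV x), ← hνl x ⟨x, hxV x⟩]
    exact (hun x).1.1 ⟨x, hxV x⟩ v
  · -- unit
    rw [hval, ← hνl x ⟨x, hxV x⟩]
    exact (hun x).1.2 ⟨x, hxV x⟩
  · -- future
    rw [← hνl x ⟨x, hxV x⟩]
    exact (hun x).2 ⟨x, hxV x⟩
  · -- smooth lift
    rw [contMDiffAt_totalSpace]
    refine ⟨(hFs x).1, ?_⟩
    simp only [trivializationAt_model_space_apply]
    exact hνs x
  · -- second fundamental form
    intro inst x v w
    have hG₀ : ∀ y : E4, Minkowski.smoothMetric.toPseudoRiemannianMetric.val y = Minkowski.bilin :=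
      fun _ ↦ rfl
    have hνd : MDifferentiableAt (𝓡 3) 𝓘(ℝ, E4) ν x := (hνs x).mdifferentiableAt (by simp)
    have hfl : MDifferentiableAt 𝓘(ℝ, E3) 𝓘(ℝ, E4) (fl x) ⟨x, hxV x⟩ :=
      ((hfi x).contMDiff_self _).mdifferentiableAt (by simp)
    have hνly : (fun z : V x ↦ (νl x z : E4)) = ν ∘ Subtype.val := funext (hνl x)
    have hval' : MDifferentiableAt 𝓘(ℝ, E3) (𝓡 3) (Subtype.val : V x → X) ⟨x, hxV x⟩ :=
      (contMDiff_subtype_val (n := ∞) _).mdifferentiableAt (by simp)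
    have hνld : MDifferentiableAt 𝓘(ℝ, E3) 𝓘(ℝ, E4) (fun z : V x ↦ (νl x z : E4)) ⟨x, hxV x⟩ := by
      rw [hνly]
      exact hνd.comp _ hval'
    have hdν : mfderiv 𝓘(ℝ, E3) 𝓘(ℝ, E4) (fun z : V x ↦ (νl x z : E4)) ⟨x, hxV x⟩ v =
        mfderiv (𝓡 3) 𝓘(ℝ, E4) ν x v := by
      rw [hνly, mfderiv_comp_subtypeVal hνd]
      rfl
    have hKl := hK x ⟨x, hxV x⟩ v w
    rw [ModelSpace.secondFundamentalForm_eq_mfderiv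
      (g := Minkowski.smoothMetric.toPseudoRiemannianMetric) (I' := 𝓘(ℝ, E3)) hG₀
      BoundarylessManifold.isInteriorPoint hfl hνld v w, hdν, ← hdFl x x (hxV x) w] at hKl
    rw [ModelSpace.secondFundamentalForm_eq_mfderiv
      (g := Minkowski.smoothMetric.toPseudoRiemannianMetric) (I' := 𝓡 3) hG₀
      BoundarylessManifold.isInteriorPoint (hFd x) hνd v w]
    exact hKl

end InitialDataSet

end Literature.Geometry.Lorentzian

end
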